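import Literature.AnabelianGeometry.AbsoluteAnabelian.AutHolomorphicSpacesTransportProofs
import Mathlib.Analysis.Convex.Contractible
import Mathlib.AlgebraicTopology.FundamentalGroupoid.SimplyConnected
import HarnessLib

/-!
# Chart discs and Riemann-mapping discs (PROOF-ONLY support for [AbsTopIII] Cor. 2.3)

The localisation step of [AbsTopIII] Cor. 2.3 (i) ("by applying Proposition 2.2, (i), to sufficiently
small open discs in `X^top`", p.53) needs, inside a Riemann surface, connected open sets carrying a
biholomorphic homeomorphism onto the unit disc `unitDiscOpens`.  This file supplies them (all
statements existential; no definitions):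

* `exists_chartDisc` — around any point and inside any open neighbourhood there is a connected open
  `D` (the preimage of a small ball under the preferred chart) with a biholomorphic
  `↥D ≃ₜ unitDiscOpens`;
* `exists_discParam_of_subset_source` — an open `V` inside a chart domain, with bounded chart
  image and homeomorphic to the disc, carries a biholomorphic `↥V ≃ₜ unitDiscOpens`: its chart
  image is open, simply connected and `≠ ℂ`, so the TREE's Riemann mapping theorem
  (`Complex.exists_bijOn_ball_of_isSimplyConnected`, `Literature/Analysis/Complex/RiemannMapping`)
  applies;
* `exists_opens_image_homeomorph` — the image of an open `D ⊆ source` under an open partial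
  homeomorphism, as an `Opens`, with the induced homeomorphism;
* `mdifferentiableAt_extend_subtype` — extending an `MDifferentiable` map off an open subtype.

[cite: MochizukiAbsTopIII2015, Corollary 2.3 (i) p.53]
-/

noncomputable section

namespace Literature.AnabelianGeometry.AbsoluteAnabelian

open _root_.TopologicalSpace _root_.Topology _root_.Set _root_.Metric _root_.Function _root_.Filter
open scoped _root_.Manifold _root_.ContDiff ComplexConjugate
open Literature.Analysis.Complex

/-! ### Extending maps off open subtypes -/

section Extend

variable {M N : Type*} [TopologicalSpace M] [ChartedSpace ℂ M] [TopologicalSpace N] [ChartedSpace ℂ N]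

/-- The extension (by a constant off `U`, `Function.extend Subtype.val`) of a `ℂ`-differentiable map
on an open subtype `U` is `ℂ`-differentiable at the points of `U`.
[cite: MochizukiAbsTopIII2015, Definition 2.1 (i) p.50] -/
theorem mdifferentiableAt_extend_subtype {U : Opens M} (Ψ : U → N) (n₀ : N) {p : M} (hp : p ∈ U)
    (hΨ : MDifferentiableAt 𝓘(ℂ, ℂ) 𝓘(ℂ, ℂ) Ψ ⟨p, hp⟩) :
    MDifferentiableAt 𝓘(ℂ, ℂ) 𝓘(ℂ, ℂ) (Function.extend Subtype.val Ψ fun _ => n₀) p :=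
  (mdifferentiableAt_opens_dom_iff (U := U) (Ψ := Ψ)
    (Φ := Function.extend Subtype.val Ψ fun _ => n₀)
    (fun x => (Subtype.val_injective.extend_apply _ _ x).symm) ⟨p, hp⟩).1 hΨ

omit [ChartedSpace ℂ M] in
/-- Value of the extension at a point of `U`. [cite: MochizukiAbsTopIII2015, Definition 2.1 (i) p.50] -/
theorem extend_subtype_apply {U : Opens M} {β : Type*} (Ψ : U → β) (b : β) {p : M} (hp : p ∈ U) :
    Function.extend Subtype.val Ψ (fun _ => b) p = Ψ ⟨p, hp⟩ :=
  Subtype.val_injective.extend_apply _ _ (⟨p, hp⟩ : U)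

end Extend

/-! ### Chart discs -/

section ChartDisc

variable {X : Type*} [TopologicalSpace X] [ChartedSpace ℂ X] [IsManifold 𝓘(ℂ, ℂ) ω X]

/-- **Chart discs.**  Every point `y` of a Riemann surface has, inside any open neighbourhood `W`,
a connected open neighbourhood `D` — the preimage of a small ball under the preferred chart at `y` —
together with a biholomorphic homeomorphism `↥D ≃ₜ unitDiscOpens` (an affine rescaling of the chart).
[cite: MochizukiAbsTopIII2015, Corollary 2.3 (i) p.53] -/
theorem exists_chartDisc (y : X) {W : Set X} (hW : IsOpen W) (hyW : y ∈ W) :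
    ∃ (D : Opens X) (eD : D ≃ₜ unitDiscOpens), y ∈ D ∧ (D : Set X) ⊆ W ∧ IsConnected (D : Set X) ∧
      MDifferentiable 𝓘(ℂ, ℂ) 𝓘(ℂ, ℂ) eD ∧ MDifferentiable 𝓘(ℂ, ℂ) 𝓘(ℂ, ℂ) eD.symm := by
  set c := chartAt ℂ y with hc
  have hys : y ∈ c.source := mem_chart_source ℂ y
  -- a ball in the chart whose preimage lies in `W ∩ c.source`
  set O : Set ℂ := c.target ∩ c.symm ⁻¹' (W ∩ c.source) with hO
  have hOo : IsOpen O := c.symm.isOpen_inter_preimage (hW.inter c.open_source)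
  have hyO : c y ∈ O := ⟨mem_chart_target ℂ y, by
    show c.symm (c y) ∈ W ∩ c.source
    rw [c.left_inv hys]; exact ⟨hyW, hys⟩⟩
  obtain ⟨r, hr, hball⟩ := Metric.isOpen_iff.1 hOo (c y) hyO
  set w₀ := c y with hw₀
  -- the disc `D`
  let D : Opens X := ⟨c.source ∩ c ⁻¹' ball w₀ r, c.isOpen_inter_preimage isOpen_ball⟩
  have hDmem : ∀ {p : X}, p ∈ D ↔ p ∈ c.source ∧ c p ∈ ball w₀ r := fun {p} => Iff.rfl
  have hyD : y ∈ D := hDmem.2 ⟨hys, by rw [hw₀]; exact mem_ball_self hr⟩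
  have hDW : (D : Set X) ⊆ W := by
    intro p hp
    have hp' := hDmem.1 hp
    have h1 := hball hp'.2
    have h2 : c.symm (c p) ∈ W ∩ c.source := h1.2
    rw [c.left_inv hp'.1] at h2
    exact h2.1
  have hDimage : (D : Set X) = c.symm '' ball w₀ r := by
    ext p
    constructor
    · intro hp
      have hp' := hDmem.1 hp
      exact ⟨c p, hp'.2, c.left_inv hp'.1⟩
    · rintro ⟨w, hw, rfl⟩
      have hwt : w ∈ c.target := (hball hw).1
      exact hDmem.2 ⟨c.map_target hwt, by rw [c.right_inv hwt]; exact hw⟩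
  have hDconn : IsConnected (D : Set X) := by
    rw [hDimage]
    exact ((convex_ball w₀ r).isConnected ⟨w₀, mem_ball_self hr⟩).image _
      (c.continuousOn_symm.mono fun w hw => (hball hw).1)
  -- the affine parametrisation
  have hnorm : ∀ p : D, ‖(c p - w₀) / r‖ < 1 := by
    intro p
    have hp := (hDmem.1 p.2).2
    rw [mem_ball, dist_eq_norm] at hp
    rw [norm_div, Complex.norm_real, Real.norm_of_nonneg hr.le, div_lt_one hr]
    exact hp
  have hback : ∀ u : unitDiscOpens, w₀ + r * (u : ℂ) ∈ ball w₀ r := by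
    intro u
    rw [mem_ball, dist_eq_norm, add_sub_cancel_left, norm_mul, Complex.norm_real,
      Real.norm_of_nonneg hr.le]
    calc r * ‖(u : ℂ)‖ < r * 1 := by gcongr; exact norm_coe_lt_one u
      _ = r := mul_one r
  have hr0 : (r : ℂ) ≠ 0 := by exact_mod_cast hr.ne'
  have hmemF : ∀ p : D, (c p - w₀) / r ∈ unitDiscOpens := fun p => mem_unitDiscOpens.2 (hnorm p)
  have hmemI : ∀ u : unitDiscOpens, c.symm (w₀ + r * u) ∈ D := fun u =>
    hDmem.2 ⟨c.map_target (hball (hback u)).1, by rw [c.right_inv (hball (hback u)).1]; exact hback u⟩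
  let toF : D → unitDiscOpens := fun p => ⟨(c p - w₀) / r, hmemF p⟩
  let invF : unitDiscOpens → D := fun u => ⟨c.symm (w₀ + r * u), hmemI u⟩
  have hcontF : Continuous toF := by
    refine Continuous.subtype_mk ?_ hmemF
    exact ((c.continuousOn.comp_continuous continuous_subtype_val fun p => (hDmem.1 p.2).1).sub
      continuous_const).div_const _
  have hcontI : Continuous invF := by
    refine Continuous.subtype_mk ?_ hmemI
    exact c.continuousOn_symm.comp_continuous (by fun_prop) fun u => (hball (hback u)).1
  let eD : D ≃ₜ unitDiscOpens :=
    { toFun := toF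
      invFun := invF
      left_inv := fun p => by
        apply Subtype.ext
        show c.symm (w₀ + r * ((c p - w₀) / r)) = p
        rw [mul_div_cancel₀ _ hr0, add_sub_cancel, c.left_inv (hDmem.1 p.2).1]
      right_inv := fun u => by
        apply Subtype.ext
        show (c (c.symm (w₀ + r * u)) - w₀) / r = u
        rw [c.right_inv (hball (hback u)).1, add_sub_cancel_left, mul_div_cancel_left₀ _ hr0]
      continuous_toFun := hcontF
      continuous_invFun := hcontI }
  -- holomorphy of the parametrisation and its inverse
  have hΦ : ∀ p : D, MDifferentiableAt 𝓘(ℂ, ℂ) 𝓘(ℂ, ℂ) ((fun w : ℂ => (w - w₀) / r) ∘ c) p := by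
    intro p
    have h1 : MDifferentiableAt 𝓘(ℂ, ℂ) 𝓘(ℂ, ℂ) c p :=
      mdifferentiableAt_atlas (chart_mem_atlas ℂ y) (hDmem.1 p.2).1
    have h2 : MDifferentiableAt 𝓘(ℂ, ℂ) 𝓘(ℂ, ℂ) (fun w : ℂ => (w - w₀) / r) (c p) :=
      mdifferentiableAt_iff_differentiableAt.2 ((differentiableAt_id.sub_const _).div_const _)
    exact h2.comp _ h1
  have hΨ : ∀ u : unitDiscOpens,
      MDifferentiableAt 𝓘(ℂ, ℂ) 𝓘(ℂ, ℂ) (c.symm ∘ fun w : ℂ => w₀ + r * w) u := by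
    intro u
    have h1 : MDifferentiableAt 𝓘(ℂ, ℂ) 𝓘(ℂ, ℂ) (fun w : ℂ => w₀ + r * w) u :=
      mdifferentiableAt_iff_differentiableAt.2 ((differentiableAt_id.const_mul _).const_add _)
    have h2 : MDifferentiableAt 𝓘(ℂ, ℂ) 𝓘(ℂ, ℂ) c.symm ((fun w : ℂ => w₀ + r * w) u) :=
      mdifferentiableAt_atlas_symm (chart_mem_atlas ℂ y) (hball (hback u)).1
    exact MDifferentiableAt.comp (u : ℂ) (f := fun w : ℂ => w₀ + r * w) h2 h1
  refine ⟨D, eD, hyD, hDW, hDconn, fun p => ?_, fun u => ?_⟩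
  · exact (mdifferentiableAt_opens_iff (Ψ := eD) (Φ := (fun w : ℂ => (w - w₀) / r) ∘ c)
      (fun _ => rfl) p).2 (hΦ p)
  · exact (mdifferentiableAt_opens_iff (Ψ := eD.symm) (Φ := c.symm ∘ fun w : ℂ => w₀ + r * w)
      (fun _ => rfl) u).2 (hΨ u)

end ChartDisc

/-! ### Riemann-mapping discs -/

section RMDisc

variable {Y : Type*} [TopologicalSpace Y] [ChartedSpace ℂ Y] [IsManifold 𝓘(ℂ, ℂ) ω Y]

/-- `unitDiscOpens` is contractible (a convex set). [cite: MochizukiAbsTopIII2015, Definition 2.1 (i) p.50] -/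
theorem contractibleSpace_unitDiscOpens : ContractibleSpace unitDiscOpens :=
  (convex_ball (0 : ℂ) 1).contractibleSpace ⟨0, mem_ball_self one_pos⟩

/-- **Riemann-mapping discs.**  Let `c` be a chart of the Riemann surface `Y` and `V` an open
subset of its domain whose chart image is bounded and which is homeomorphic to the unit disc.  Then
`V` carries a biholomorphic homeomorphism `↥V ≃ₜ unitDiscOpens` (the chart followed by a Riemann map
of the simply connected proper open `c(V) ⊊ ℂ`). [cite: MochizukiAbsTopIII2015, Corollary 2.3 (i) p.53] -/
theorem exists_discParam_of_subset_source {c : OpenPartialHomeomorph Y ℂ} (hc : c ∈ atlas ℂ Y)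
    (V : Opens Y) (hVs : (V : Set Y) ⊆ c.source) {w₀ : ℂ} {ρ : ℝ}
    (hVb : c '' (V : Set Y) ⊆ ball w₀ ρ) (hV : Nonempty (V ≃ₜ unitDiscOpens)) :
    ∃ eV : V ≃ₜ unitDiscOpens,
      MDifferentiable 𝓘(ℂ, ℂ) 𝓘(ℂ, ℂ) eV ∧ MDifferentiable 𝓘(ℂ, ℂ) 𝓘(ℂ, ℂ) eV.symm := by
  obtain ⟨τ⟩ := hV
  set Ω : Set ℂ := c '' (V : Set Y) with hΩ
  have hΩo : IsOpen Ω := c.isOpen_image_of_subset_source V.isOpen hVs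
  have hΩt : Ω ⊆ c.target := by
    rintro _ ⟨p, hp, rfl⟩; exact c.map_source (hVs hp)
  -- `Ω ≅ V ≅ 𝔻` is contractible, hence simply connected
  have hmemΩ : ∀ p : V, c p ∈ Ω := fun p => mem_image_of_mem _ p.2
  have hmemV : ∀ w : Ω, c.symm w ∈ V := by
    intro w
    obtain ⟨p, hp, hpw⟩ := w.2
    rw [← hpw, c.left_inv (hVs hp)]; exact hp
  let σ : V ≃ₜ Ω :=
    { toFun := fun p => ⟨c p, hmemΩ p⟩
      invFun := fun w => ⟨c.symm w, hmemV w⟩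
      left_inv := fun p => Subtype.ext (c.left_inv (hVs p.2))
      right_inv := fun w => Subtype.ext (c.right_inv (hΩt w.2))
      continuous_toFun := (c.continuousOn.comp_continuous continuous_subtype_val
        fun p => hVs p.2).subtype_mk hmemΩ
      continuous_invFun := (c.continuousOn_symm.comp_continuous continuous_subtype_val
        fun w => hΩt w.2).subtype_mk hmemV }
  haveI : ContractibleSpace unitDiscOpens := contractibleSpace_unitDiscOpens
  haveI : ContractibleSpace Ω := (σ.symm.trans τ).contractibleSpace
  have hΩsc : IsSimplyConnected Ω := SimplyConnectedSpace.ofContractible Ω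
  have hΩne : Ω ≠ univ := by
    intro h
    have hmem : w₀ + ρ ∈ Ω := by rw [h]; exact mem_univ _
    have := hVb hmem
    rw [mem_ball, dist_eq_norm, add_sub_cancel_left, Complex.norm_real, Real.norm_eq_abs] at this
    exact (lt_irrefl ρ) ((le_abs_self ρ).trans_lt this)
  -- a Riemann map of `Ω`
  obtain ⟨f, hfd, hbij, hfinv⟩ := Complex.exists_bijOn_ball_differentiableOn_invFunOn hΩo hΩsc hΩne
  set fi := invFunOn f Ω with hfi
  have hfi_mem : ∀ {u : ℂ}, u ∈ ball (0 : ℂ) 1 → fi u ∈ Ω := fun hu => invFunOn_mem (hbij.surjOn hu)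
  have hfi_right : ∀ {u : ℂ}, u ∈ ball (0 : ℂ) 1 → f (fi u) = u := fun hu => invFunOn_eq (hbij.surjOn hu)
  have hfi_left : ∀ {w : ℂ}, w ∈ Ω → fi (f w) = w := fun hw => hbij.injOn.leftInvOn_invFunOn hw
  have hmemF : ∀ p : V, f (c p) ∈ unitDiscOpens := fun p => hbij.mapsTo (mem_image_of_mem _ p.2)
  have hmemI : ∀ u : unitDiscOpens, c.symm (fi u) ∈ V := by
    intro u
    obtain ⟨p, hp, hpw⟩ := hfi_mem u.2
    rw [← hpw, c.left_inv (hVs hp)]; exact hp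
  let toF : V → unitDiscOpens := fun p => ⟨f (c p), hmemF p⟩
  let invF : unitDiscOpens → V := fun u => ⟨c.symm (fi u), hmemI u⟩
  have hcontF : Continuous toF :=
    ((hfd.continuousOn.comp (c.continuousOn.mono hVs) fun p hp => mem_image_of_mem _ hp).comp_continuous
      continuous_subtype_val fun p => p.2).subtype_mk hmemF
  have hcontI : Continuous invF :=
    ((c.continuousOn_symm.comp hfinv.continuousOn fun u hu => hΩt (hfi_mem hu)).comp_continuous
      continuous_subtype_val fun u => u.2).subtype_mk hmemI
  let eV : V ≃ₜ unitDiscOpens :=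
    { toFun := toF
      invFun := invF
      left_inv := fun p => by
        apply Subtype.ext
        show c.symm (fi (f (c p))) = p
        rw [hfi_left (mem_image_of_mem _ p.2), c.left_inv (hVs p.2)]
      right_inv := fun u => by
        apply Subtype.ext
        show f (c (c.symm (fi u))) = u
        rw [c.right_inv (hΩt (hfi_mem u.2)), hfi_right u.2]
      continuous_toFun := hcontF
      continuous_invFun := hcontI }
  have hΦ : ∀ p : V, MDifferentiableAt 𝓘(ℂ, ℂ) 𝓘(ℂ, ℂ) (f ∘ c) p := by
    intro p
    have h1 : MDifferentiableAt 𝓘(ℂ, ℂ) 𝓘(ℂ, ℂ) c p := mdifferentiableAt_atlas hc (hVs p.2)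
    have h2 : MDifferentiableAt 𝓘(ℂ, ℂ) 𝓘(ℂ, ℂ) f (c p) :=
      mdifferentiableAt_iff_differentiableAt.2
        (hfd.differentiableAt (hΩo.mem_nhds (mem_image_of_mem _ p.2)))
    exact h2.comp _ h1
  have hΨ : ∀ u : unitDiscOpens, MDifferentiableAt 𝓘(ℂ, ℂ) 𝓘(ℂ, ℂ) (c.symm ∘ fi) u := by
    intro u
    have h1 : MDifferentiableAt 𝓘(ℂ, ℂ) 𝓘(ℂ, ℂ) fi u :=
      mdifferentiableAt_iff_differentiableAt.2 (hfinv.differentiableAt (isOpen_ball.mem_nhds u.2))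
    have h2 : MDifferentiableAt 𝓘(ℂ, ℂ) 𝓘(ℂ, ℂ) c.symm (fi u) :=
      mdifferentiableAt_atlas_symm hc (hΩt (hfi_mem u.2))
    exact h2.comp _ h1
  refine ⟨eV, fun p => ?_, fun u => ?_⟩
  · exact (mdifferentiableAt_opens_iff (Ψ := eV) (Φ := f ∘ c) (fun _ => rfl) p).2 (hΦ p)
  · exact (mdifferentiableAt_opens_iff (Ψ := eV.symm) (Φ := c.symm ∘ fi) (fun _ => rfl) u).2 (hΨ u)

end RMDisc

/-! ### Images of opens under open partial homeomorphisms -/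

section Image

variable {X Y : Type*} [TopologicalSpace X] [TopologicalSpace Y]

/-- The image of an open `D ⊆ source` under an open partial homeomorphism `g`, as an open of `Y`,
together with the induced homeomorphism `↥D ≃ₜ ↥g(D)`. [cite: MochizukiAbsTopIII2015, Corollary 2.3 (i) p.53] -/
theorem exists_opens_image_homeomorph (g : OpenPartialHomeomorph X Y) (D : Opens X)
    (hD : (D : Set X) ⊆ g.source) :
    ∃ (V : Opens Y) (e : D ≃ₜ V), (V : Set Y) = g '' (D : Set X) ∧ ∀ p : D, (e p : Y) = g p := by
  let V : Opens Y := ⟨g '' (D : Set X), g.isOpen_image_of_subset_source D.isOpen hD⟩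
  have hVt : (V : Set Y) ⊆ g.target := by
    rintro _ ⟨p, hp, rfl⟩; exact g.map_source (hD hp)
  have hmemV : ∀ p : D, g p ∈ V := fun p => mem_image_of_mem _ p.2
  have hmemD : ∀ q : V, g.symm q ∈ D := by
    intro q
    obtain ⟨p, hp, hpq⟩ := q.2
    rw [← hpq, g.left_inv (hD hp)]; exact hp
  let e : D ≃ₜ V :=
    { toFun := fun p => ⟨g p, hmemV p⟩
      invFun := fun q => ⟨g.symm q, hmemD q⟩
      left_inv := fun p => Subtype.ext (g.left_inv (hD p.2))
      right_inv := fun q => Subtype.ext (g.right_inv (hVt q.2))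
      continuous_toFun := (g.continuousOn.comp_continuous continuous_subtype_val
        fun p => hD p.2).subtype_mk hmemV
      continuous_invFun := (g.continuousOn_symm.comp_continuous continuous_subtype_val
        fun q => hVt q.2).subtype_mk hmemD }
  exact ⟨V, e, rfl, fun p => rfl⟩

end Image

end Literature.AnabelianGeometry.AbsoluteAnabelian
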